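import Literature.AlgebraicGeometry.Resolution.AbhyankarToroidalCharts
import HarnessLib

/-!
# Abhyankar valued fields under an algebraic extension of the constants (Temkin 2013, §5.5: bricks for Thm. 5.5.2)

Topic: `Literature/AlgebraicGeometry/Resolution`. PROVED bricks for the assembly of the named fact
`Temkin2013Abhyankar` (`InseparableLocalUniformizationAbhyankar.lean`; M. Temkin, *Inseparable
local uniformization*, J. Algebra 373 (2013) 65–119 = arXiv:0804.1554v3, Thm. 5.5.2 (i), `n = 1`)
from the §5 facts of `AbhyankarToroidalCharts.lean`. The printed proof of Thm. 5.5.2 (pp. 60–61)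
first passes to the constant extension `l/k` of Thm. 5.5.3 ("it suffices to prove the Theorem for
`l`, `L = lK`, `X_L = Nr_L(X)` and `L₁, …, L_n` instead of the original `k`, `K`, `X` and
`K₁, …, K_n`"), then works with TWO Abhyankar bases of the finite extension `K₁ ⊇ K`: one adapted
to `K₁` as in Thm. 5.5.1 (iii) ("Find an Abhyankar transcendence basis `B` … as in Theorem 5.5.1
(iii)": residues a separating transcendence basis, values a basis of `|K₁^×|`), and one inside `K`
("Notice that `B` is an Abhyankar basis of each `Kᵢ`"). The bases themselves (existence, finite extensions,
adapted bases — over ONE constant field) are PROVED in `AbhyankarBases.lean`; this file supplies the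
passage from the constants `k` to `l`, in the rendering of `IsAbhyankarBasis`
(`AbhyankarToroidalCharts.lean`) and of the invariants `E`, `F`, `D` (`TranscendenceDefect.lean`):

* `transcendenceDefect_eq_of_isAlgebraic_constants` (with `trdeg_…`, `residueTrdeg_…`): for
  `k ⊆ l ⊆ L°` with `l/k` algebraic, `D_{L/l} = D_{L/k}` (and `N`, `F` agree; `L/l` is finitely
  generated if `L/k` is, Mathlib's `IntermediateField.FG.of_restrictScalars`), so that the
  §5 facts, stated for a finitely generated Abhyankar valued field over its trivially valued field of
  constants, apply to `(L₁ = lK₁, l)`.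
* `IsAbhyankarBasis.of_isAlgebraic_constants`: an Abhyankar basis of `(L, L°)` over `k` is one over
  `l` (algebraic independence over `k` passes to the algebraic extension `l`, Mathlib's
  `Algebra.IsAlgebraic.isTranscendenceBasis_iff`) — giving, with `IsAbhyankarBasis.extension`
  (`AbhyankarBases.lean`), the Abhyankar basis `B ⊂ K` of `(L₁, L₁°)` over `l`.

## Sources

* M. Temkin, *Inseparable local uniformization*, arXiv:0804.1554v3: §2.1 and Remark 2.1.3
  (pp. 9–10), Thm. 5.5.1 (p. 59), proof of Thm. 5.5.2 (pp. 60–61).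
-/

noncomputable section

namespace Literature.AlgebraicGeometry.Resolution

open IsLocalRing ValuationSubring Cardinal

universe u

/-! ### Algebraic extension of the constants: `k ⊆ l ⊆ L°` -/

section Constants

variable {k l L : Type u} [Field k] [Field l] [Field L] [Algebra k l] [Algebra l L] [Algebra k L]
  [IsScalarTower k l L] (O : ValuationSubring L)
  (hk : ∀ c : k, algebraMap k L c ∈ O) (hl : ∀ c : l, algebraMap l L c ∈ O)

/-- `tr.deg._l(L) = tr.deg._k(L)` for `l/k` algebraic. [folklore] -/
theorem trdeg_eq_of_isAlgebraic_constants [Algebra.IsAlgebraic k l] :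
    Algebra.trdeg l L = Algebra.trdeg k L := by
  have h := trdeg_add_eq k l (A := L)
  rwa [trdeg_eq_zero, zero_add] at h

include hk in
/-- The two constant-field structures on the residue field are compatible. [folklore] -/
theorem isScalarTower_residueField_of_constants :
    letI := algebraOfMem k O hk
    letI := algebraOfMem l O hl
    IsScalarTower k l (ResidueField O) := by
  letI := algebraOfMem k O hk
  letI := algebraOfMem l O hl
  haveI : IsScalarTower k l O := IsScalarTower.of_algebraMap_eq fun c =>
    Subtype.ext (IsScalarTower.algebraMap_apply k l L c)
  exact IsScalarTower.of_algebraMap_eq fun c => by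
    rw [IsScalarTower.algebraMap_apply k O (ResidueField O),
      IsScalarTower.algebraMap_apply l O (ResidueField O), IsScalarTower.algebraMap_apply k l O]

/-- `F_{L/l} = F_{L/k}` for `l/k` algebraic. [folklore] -/
theorem residueTrdeg_eq_of_isAlgebraic_constants [Algebra.IsAlgebraic k l] :
    residueTrdeg l O hl = residueTrdeg k O hk := by
  letI := algebraOfMem k O hk
  letI := algebraOfMem l O hl
  haveI := isScalarTower_algebraOfMem k O hk
  haveI := isScalarTower_algebraOfMem l O hl
  haveI := isScalarTower_residueField_of_constants O hk hl
  rw [residueTrdeg_eq O hk, residueTrdeg_eq O hl]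
  have h := trdeg_add_eq k l (A := ResidueField O)
  rwa [trdeg_eq_zero, zero_add] at h

/-- **`D_{L/l} = D_{L/k}` for an algebraic extension `l/k` of the (trivially valued) constants**
(`N`, `E`, `F` are unchanged). [folklore] -/
theorem transcendenceDefect_eq_of_isAlgebraic_constants [Algebra.IsAlgebraic k l] :
    transcendenceDefect l O hl = transcendenceDefect k O hk := by
  unfold transcendenceDefect
  rw [trdeg_eq_of_isAlgebraic_constants (k := k) (l := l) (L := L),
    residueTrdeg_eq_of_isAlgebraic_constants O hk hl]

end Constants

/-! ### Abhyankar bases under an algebraic extension of the constants -/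

section ConstantsBasis

variable {k l L : Type u} [Field k] [Field l] [Field L] [Algebra k l] [Algebra l L] [Algebra k L]
  [IsScalarTower k l L] (O : ValuationSubring L)
  (hk : ∀ c : k, algebraMap k L c ∈ O) (hl : ∀ c : l, algebraMap l L c ∈ O)

include hk in
/-- **An Abhyankar basis over `k` is an Abhyankar basis over an algebraic extension `l ⊆ L°` of the
constants** (Temkin 2013, proof of Thm. 5.5.2, p. 60: after "it suffices to prove the Theorem for
`l`, `L = lK`", the bases of §5 are taken over `l`): the value conditions do not see the constants,
and a transcendence basis over `k` (of `L`, resp. of `L̃`) stays one over the algebraic extension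
`l` (Mathlib's `Algebra.IsAlgebraic.isTranscendenceBasis_iff`). PROVED.
[cite: Temkin2013, proof of Thm. 5.5.2 (p. 60 of arXiv:0804.1554v3)] -/
theorem IsAbhyankarBasis.of_isAlgebraic_constants [Algebra.IsAlgebraic k l] {κ ι : Type*}
    {x : κ → L} {y : ι → O} (hB : IsAbhyankarBasis O hk x y) : IsAbhyankarBasis O hl x y where
  ne_zero := hB.ne_zero
  linearIndependent := hB.linearIndependent
  exists_pow_mem_closure := hB.exists_pow_mem_closure
  isTranscendenceBasis_residue := by
    letI := algebraOfMem k O hk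
    letI := algebraOfMem l O hl
    haveI := isScalarTower_residueField_of_constants O hk hl
    exact (Algebra.IsAlgebraic.isTranscendenceBasis_iff k l).mp hB.isTranscendenceBasis_residue
  isTranscendenceBasis :=
    (Algebra.IsAlgebraic.isTranscendenceBasis_iff k l).mp hB.isTranscendenceBasis

end ConstantsBasis

end Literature.AlgebraicGeometry.Resolution
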